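/-
Copyright: the b2b-balaban T⁴-continuum CRUX team, row NE7b leaf lineage `t4-ne7b-formalise-leaf-03` (gen 140). Project licence.
-/
import Mathlib.Analysis.Calculus.Gradient.Basic
import Mathlib.Analysis.Calculus.LocalExtr.Basic
import Mathlib.Analysis.InnerProductSpace.Calculus
import Mathlib.Analysis.InnerProductSpace.PiL2

/-!
# THE MINIMISER OF THE CONVEXITY ROAD'S EXPONENT EXISTS, IS UNIQUE, AND IS ITS ONLY CRITICAL POINT: the `x₀ ∕ hcrit ∕ hlow`
# binders of `…ConvexWindowMass` SUPPLIED from the first-order letter alone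
# (row NE7b, node U5c; companion of `…ConvexWindowMass` ∕ `…ConvexTiltMoment`; kernel lemmas of real analysis, Mathlib only)

Cell `pub-balaban`, sub-cell `t4`, spine estimate NE7b (`T4WeightBudget.RelWeightBound`; the cell's OWN estimate — NOT PRINTED in
[Bałaban 1983–89], NOT PROVED).  Crux-route work under `Spine/NE7b/` by a row leaf on the convexity road; NOTHING of Bałaban's is named
or asserted; no `T4Continuum/Support` leaf typed; no `def`; zero `sorry`.

WHY.  Every file of the convexity road consumes ONE letter about the exponent `V` of the tilted density — the FIRST-ORDER uniform
convexity `hV : V x + ⟪∇V x, y − x⟫ + (λ∕2)‖y − x‖² ≤ V y` (`…ConvexTiltMoment`, `…ConvexTiltSuppliers`).  The OWNER's window-mass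
supplier `…ConvexWindowMass` (the ball ∕ two-sided pinch model) DISPLAYS in addition a point `x₀` with `hcrit : ∇V x₀ = 0`
(`lowerPinch_of_firstOrder`) resp. the lower pinch `hlow : V x₀ + (λ∕2)‖y − x₀‖² ≤ V y` AT `x₀` (`tailIntegral_exp_neg_le_of_lowerPinch`,
`ballMass_ge_of_pinch`); the pricing desk books «the road will also need `∃ x₀, gradient V x₀ = 0` (minimiser of a coercive C¹ strictly
convex V — S-sized [folklore], binder displayed)» (PRICING-NE7b v77 Q-ne7bref-g70-1) and names `x₀` = «the minimiser of the SAME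
globalised V whose measure is tilted» as the reference point of the slab road's CENTRING letter (v80 F428 (σ4)).  THIS FILE discharges
that binder from `hV`, `0 < λ` and `Continuous V` ALONE.  No differentiability hypothesis is needed: Mathlib's `gradient` is the junk
value `0` off the differentiability set, so `hV` at a non-differentiability point already says that point is the strict minimiser, and
Fermat's theorem `IsLocalMin.fderiv_eq_zero` is likewise unconditional.

WHAT IS PROVED ([folklore]; the extreme value theorem `Continuous.exists_forall_le'` on the proper space `EuclideanSpace ℝ (Fin n)`,
Fermat's theorem, and the letter itself; imports Mathlib ONLY, so that no olean of the row is needed to build it):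
§1 `le_of_firstOrder_of_norm_ge` (COERCIVITY: `V 0 ≤ V y` once `‖y‖ ≥ 2‖∇V 0‖∕λ`), **`exists_forall_le_of_firstOrder`** (a global
minimiser exists), `gradient_eq_zero_of_forall_le` (Fermat, unconditional form), **`exists_gradient_eq_zero_of_firstOrder`**.
§2 `eq_of_gradient_eq_zero` (two critical points coincide: the letter at both, with vanishing gradients, gives `λ‖x₁ − x₀‖² ≤ 0`),
**`existsUnique_gradient_eq_zero_of_firstOrder`** (`∃! x₀, ∇V x₀ = 0`), `forall_le_iff_gradient_eq_zero` (minimiser ⟺ critical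
point), **`exists_minimiser_of_firstOrder`** (`∃ x₀, ∇V x₀ = 0 ∧ ∀ y, V x₀ + (λ∕2)‖y − x₀‖² ≤ V y` — the `x₀ ∕ hlow` binders of
`…ConvexWindowMass` in one package); a non-vacuity `example` (`V = ½‖x‖²`, `λ = 1`).
The by-name junction with the OWNER's `…ConvexWindowMass.ballMass_ge_of_pinch` (`x₀`, `hlow` SUPPLIED by §2, `hup` derived at the
critical point from the UPPER first-order letter) is the companion `…ConvexMinimiserBall` (which imports `…ConvexWindowMass`).

NOT HERE (honest): the identification of `V`, `λ` with Bałaban's small-field exponents ((A1c) readings); the location of `x₀`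
relative to print's window centres (F428 (σ4)); the tilted mean's distance from `x₀`; anything of Bałaban's.  NE7b NOT PRINTED ∕ NOT
PROVED; spine PROVED 0∕9; rung (B)+1 on a FINITE torus — NOT infinite volume, NOT the mass gap, NOT Clay.
HONEST DEPENDENCY: continuum YM on T⁴ ⇐ BetaPertH ∧ nine spine estimates (0/9 proved); BetaPertH ⇐ (D1) ∧ (D4) ∧ CAP+tail; G-an2-4
gates asym, D1 and NE2/3/4.
-/

set_option autoImplicit false

noncomputable section

open Real Filter Topology Metric
open scoped RealInnerProductSpace

namespace Summit.QuantumFields.BalabanUV.T4Continuum.NE7b.ConvexMinimiser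

variable {n : ℕ}

/-! ## §1 Coercivity, existence of a minimiser, Fermat -/

/-- **COERCIVITY FROM THE FIRST-ORDER LETTER**: if `V x + ⟪∇V x, y − x⟫ + (λ∕2)‖y − x‖² ≤ V y` for all `x, y` and `λ > 0`, then
`V 0 ≤ V y` for every `y` with `‖y‖ ≥ 2‖∇V 0‖∕λ`. [folklore] -/
theorem le_of_firstOrder_of_norm_ge {V : EuclideanSpace ℝ (Fin n) → ℝ} {lam : ℝ} (hlam : 0 < lam)
    (hV : ∀ x y : EuclideanSpace ℝ (Fin n), V x + ⟪gradient V x, y - x⟫ + lam / 2 * ‖y - x‖ ^ 2 ≤ V y)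
    {y : EuclideanSpace ℝ (Fin n)} (hy : 2 * ‖gradient V 0‖ / lam ≤ ‖y‖) : V 0 ≤ V y := by
  have h := hV 0 y
  rw [sub_zero] at h
  have hinner : -(‖gradient V 0‖ * ‖y‖) ≤ ⟪gradient V 0, y⟫ := by
    have h1 := abs_real_inner_le_norm (gradient V 0) y
    have h2 := neg_abs_le ⟪gradient V 0, y⟫
    linarith
  have hy' : 2 * ‖gradient V 0‖ ≤ lam * ‖y‖ := by rwa [div_le_iff₀ hlam, mul_comm ‖y‖] at hy
  have hkey : 0 ≤ -(‖gradient V 0‖ * ‖y‖) + lam / 2 * ‖y‖ ^ 2 := by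
    have : ‖gradient V 0‖ * ‖y‖ ≤ lam / 2 * ‖y‖ ^ 2 := by nlinarith [norm_nonneg y]
    linarith
  linarith

/-- **A GLOBAL MINIMISER EXISTS** for a continuous `V` satisfying the first-order `λ`-convexity letter with `λ > 0` (extreme value
theorem on the proper space `EuclideanSpace ℝ (Fin n)`: off the closed ball of radius `2‖∇V 0‖∕λ` the value `V 0` is not beaten).
[folklore] -/
theorem exists_forall_le_of_firstOrder {V : EuclideanSpace ℝ (Fin n) → ℝ} {lam : ℝ} (hlam : 0 < lam) (hVc : Continuous V)
    (hV : ∀ x y : EuclideanSpace ℝ (Fin n), V x + ⟪gradient V x, y - x⟫ + lam / 2 * ‖y - x‖ ^ 2 ≤ V y) :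
    ∃ x₀ : EuclideanSpace ℝ (Fin n), ∀ y, V x₀ ≤ V y := by
  refine hVc.exists_forall_le' 0 ?_
  have hc : (closedBall (0 : EuclideanSpace ℝ (Fin n)) (2 * ‖gradient V 0‖ / lam))ᶜ ∈ cocompact _ :=
    (isCompact_closedBall _ _).compl_mem_cocompact
  filter_upwards [hc] with y hy
  refine le_of_firstOrder_of_norm_ge hlam hV (le_of_lt ?_)
  simpa [mem_closedBall, dist_eq_norm] using hy

/-- **FERMAT, UNCONDITIONAL FORM**: at a global minimiser the (Mathlib) gradient vanishes — whether or not `V` is differentiable there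
(`IsLocalMin.fderiv_eq_zero`; off the differentiability set `gradient` is the junk value `0`). [folklore] -/
theorem gradient_eq_zero_of_forall_le {V : EuclideanSpace ℝ (Fin n) → ℝ} {x₀ : EuclideanSpace ℝ (Fin n)} (hmin : ∀ y, V x₀ ≤ V y) :
    gradient V x₀ = 0 := by
  have hloc : IsLocalMin V x₀ := Filter.Eventually.of_forall fun y => hmin y
  show (InnerProductSpace.toDual ℝ (EuclideanSpace ℝ (Fin n))).symm (fderiv ℝ V x₀) = 0
  rw [hloc.fderiv_eq_zero, map_zero]

/-- **A CRITICAL POINT EXISTS**: `∃ x₀, ∇V x₀ = 0` for continuous `V` with the first-order `λ`-convexity letter, `λ > 0` (the binder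
«`∃ x₀, gradient V x₀ = 0`» priced in PRICING-NE7b v77 Q-ne7bref-g70-1, discharged). [folklore] -/
theorem exists_gradient_eq_zero_of_firstOrder {V : EuclideanSpace ℝ (Fin n) → ℝ} {lam : ℝ} (hlam : 0 < lam) (hVc : Continuous V)
    (hV : ∀ x y : EuclideanSpace ℝ (Fin n), V x + ⟪gradient V x, y - x⟫ + lam / 2 * ‖y - x‖ ^ 2 ≤ V y) :
    ∃ x₀ : EuclideanSpace ℝ (Fin n), gradient V x₀ = 0 := by
  obtain ⟨x₀, hx₀⟩ := exists_forall_le_of_firstOrder hlam hVc hV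
  exact ⟨x₀, gradient_eq_zero_of_forall_le hx₀⟩

/-! ## §2 The critical point is the unique strict minimiser -/

/-- **TWO CRITICAL POINTS COINCIDE** (`λ > 0`): adding the two lower pinches gives `λ‖x₁ − x₀‖² ≤ 0`. [folklore] -/
theorem eq_of_gradient_eq_zero {V : EuclideanSpace ℝ (Fin n) → ℝ} {lam : ℝ} (hlam : 0 < lam)
    (hV : ∀ x y : EuclideanSpace ℝ (Fin n), V x + ⟪gradient V x, y - x⟫ + lam / 2 * ‖y - x‖ ^ 2 ≤ V y)
    {x₀ x₁ : EuclideanSpace ℝ (Fin n)} (h₀ : gradient V x₀ = 0) (h₁ : gradient V x₁ = 0) : x₀ = x₁ := by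
  have a := hV x₀ x₁
  have b := hV x₁ x₀
  rw [h₀, inner_zero_left, add_zero] at a
  rw [h₁, inner_zero_left, add_zero, norm_sub_rev] at b
  have hsq : ‖x₁ - x₀‖ ^ 2 ≤ 0 := by nlinarith
  have h0 : ‖x₁ - x₀‖ = 0 := by nlinarith [norm_nonneg (x₁ - x₀)]
  rw [norm_eq_zero, sub_eq_zero] at h0
  exact h0.symm

/-- **THE CRITICAL POINT EXISTS AND IS UNIQUE**: `∃! x₀, ∇V x₀ = 0`. [folklore] -/
theorem existsUnique_gradient_eq_zero_of_firstOrder {V : EuclideanSpace ℝ (Fin n) → ℝ} {lam : ℝ} (hlam : 0 < lam)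
    (hVc : Continuous V)
    (hV : ∀ x y : EuclideanSpace ℝ (Fin n), V x + ⟪gradient V x, y - x⟫ + lam / 2 * ‖y - x‖ ^ 2 ≤ V y) :
    ∃! x₀ : EuclideanSpace ℝ (Fin n), gradient V x₀ = 0 := by
  obtain ⟨x₀, hx₀⟩ := exists_gradient_eq_zero_of_firstOrder hlam hVc hV
  exact ⟨x₀, hx₀, fun x₁ hx₁ => eq_of_gradient_eq_zero hlam hV hx₁ hx₀⟩

/-- **MINIMISER ⟺ CRITICAL POINT** under the first-order letter (`λ ≥ 0` suffices for ⟸, Fermat for ⟹). [folklore] -/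
theorem forall_le_iff_gradient_eq_zero {V : EuclideanSpace ℝ (Fin n) → ℝ} {lam : ℝ} (hlam : 0 ≤ lam)
    (hV : ∀ x y : EuclideanSpace ℝ (Fin n), V x + ⟪gradient V x, y - x⟫ + lam / 2 * ‖y - x‖ ^ 2 ≤ V y)
    (x₀ : EuclideanSpace ℝ (Fin n)) : (∀ y, V x₀ ≤ V y) ↔ gradient V x₀ = 0 := by
  refine ⟨gradient_eq_zero_of_forall_le, fun hcrit y => ?_⟩
  have h := hV x₀ y
  rw [hcrit, inner_zero_left, add_zero] at h
  nlinarith [norm_nonneg (y - x₀)]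

/-- **THE MINIMISER PACKAGE** (the `x₀ ∕ hlow` binders of `…ConvexWindowMass` SUPPLIED; the second conjunct is the content of the OWNER's
`…ConvexWindowMass.lowerPinch_of_firstOrder` at the supplied point): for continuous `V` with the first-order `λ`-convexity letter, `λ > 0`,
there is `x₀` with `∇V x₀ = 0` and `V x₀ + (λ∕2)‖y − x₀‖² ≤ V y` for all `y`. [folklore] -/
theorem exists_minimiser_of_firstOrder {V : EuclideanSpace ℝ (Fin n) → ℝ} {lam : ℝ} (hlam : 0 < lam) (hVc : Continuous V)
    (hV : ∀ x y : EuclideanSpace ℝ (Fin n), V x + ⟪gradient V x, y - x⟫ + lam / 2 * ‖y - x‖ ^ 2 ≤ V y) :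
    ∃ x₀ : EuclideanSpace ℝ (Fin n), gradient V x₀ = 0 ∧ ∀ y, V x₀ + lam / 2 * ‖y - x₀‖ ^ 2 ≤ V y := by
  obtain ⟨x₀, hx₀⟩ := exists_gradient_eq_zero_of_firstOrder hlam hVc hV
  refine ⟨x₀, hx₀, fun y => ?_⟩
  have h := hV x₀ y
  rwa [hx₀, inner_zero_left, add_zero] at h

/-- Non-vacuity toy: the hypotheses of `exists_minimiser_of_firstOrder` are jointly inhabited — `V = ½‖x‖²`, `λ = 1`, any `n`
(`∇V x = x`; the letter holds with equality by the polarisation identity). -/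
example : ∃ x₀ : EuclideanSpace ℝ (Fin n), gradient (fun x : EuclideanSpace ℝ (Fin n) => 1 / 2 * ‖x‖ ^ 2) x₀ = 0 ∧
    ∀ y, (fun x : EuclideanSpace ℝ (Fin n) => 1 / 2 * ‖x‖ ^ 2) x₀ + 1 / 2 * ‖y - x₀‖ ^ 2 ≤
      (fun x : EuclideanSpace ℝ (Fin n) => 1 / 2 * ‖x‖ ^ 2) y := by
  have hgrad : ∀ x : EuclideanSpace ℝ (Fin n), gradient (fun x : EuclideanSpace ℝ (Fin n) => 1 / 2 * ‖x‖ ^ 2) x = x := by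
    intro x
    have h1 : HasFDerivAt (fun x : EuclideanSpace ℝ (Fin n) => ‖x‖ ^ 2) (2 • innerSL ℝ x) x :=
      (hasStrictFDerivAt_norm_sq x).hasFDerivAt
    have h2 := (h1.const_mul (1 / 2 : ℝ)).hasGradientAt
    rw [h2.gradient]
    refine ext_inner_right ℝ fun v => ?_
    rw [InnerProductSpace.toDual_symm_apply]
    simp only [FunLike.coe_smul, Pi.smul_apply, smul_eq_mul, nsmul_eq_mul]
    show 1 / 2 * (2 * ⟪x, v⟫) = ⟪x, v⟫
    ring
  refine exists_minimiser_of_firstOrder (lam := 1) one_pos ?_ ?_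
  · exact continuous_const.mul (continuous_norm.pow 2)
  · intro x y
    rw [hgrad x]
    have h := norm_sub_sq_real y x
    rw [real_inner_comm] at h
    have e : ⟪x, y - x⟫ = ⟪x, y⟫ - ‖x‖ ^ 2 := by rw [inner_sub_right, real_inner_self_eq_norm_sq]
    rw [e]
    linarith

end Summit.QuantumFields.BalabanUV.T4Continuum.NE7b.ConvexMinimiser

end
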